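import Summits.Ventures.HSemireg.ObstructionLocusLocalExtDerived
import Summits.Ventures.HSemireg.ObstructionLocusBlockOneBlock

/-!
# Venture HSemireg — (S5) OBSTRUCTION LOCUS away from secant type, XXVI: `pd_R I_S ≤ 1` for every block ideal over ANY
# commutative ring, and EXT-NOTE §6.B(b) «`Ext¹_R(I_M, I_M) = Hom_R(I_M, R/I_M)`» for every SINGLE-BLOCK model

HONEST FRAMING.  Part of the Lean side of the computation cell `pub-hsemireg` (track «S4-PUSH» (ii), seat s4-prove-2).
Plain commutative / homological algebra in `R = MvPolynomial (Fin n) K`, every `n`, EVERY commutative ring `K` (no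
domain hypothesis), with Mathlib's derived `CategoryTheory.Abelian.Ext` in `ModuleCat R` (file XXV's calculus).
Nothing here constructs a variety or a sheaf; nothing here says that HC / HC_CM / HC_AV holds; no Literature fact is
declared or used; no object is certified.  File XXV proved L1 (ii) = EXT-NOTE §6.B(b) for the SR design `I_W` (the
block `S = [n]`) over a DOMAIN `K`, on top of files VIII–X.  This file removes the domain hypothesis and allows free
coordinates, on top of files XV–XIX (the block-model series): for every block `S ⊂ [n]` and the block ideal
`I_S = (x_{S ∖ a} : a ∈ S)` of `K_S × 𝔸^{[n] ∖ S}` (file XV):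

* `blockGenMap`, `blockGenMap_surjective` — the presentation `R^S ↠ I_S`, `c ↦ Σ_a c_a x_{S∖a}`;
  **`sum_mul_sq_erase_eq_zero_iff` — the FIRST SYZYGIES over ANY commutative `K`** (Hilbert–Burch, EXT-NOTE §6.A):
  `Σ_a c_a x_{S∖a} = 0 ⟺ c_a = x_a s_a with Σ_a s_a = 0` (file VIII's `sum_mul_cofactor_eq_zero_iff` used
  `MvPolynomial.X_prime`, hence a domain; here the divisibility `x_a ∣ c_a` is read off the monomial supports with
  file XV's `coeff_sq_mul_add` and Mathlib's `support_X_mul`, and the cancellation is XV's `eq_zero_of_sq_mul_eq_zero`);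
* `kerBlockGenMapEquiv : ker Σ ≃ₗ[R] ker(R^S ↠ I_S)`; `projective_kerBlockGenMap`; `finite_blockIdeal`;
  **`hasProjectiveDimensionLE_one_blockIdeal : HasProjectiveDimensionLE (ModuleCat.of R I_S) 1`** (`pd_R I_S ≤ 1`,
  every `S`, every `n`, every commutative `K`), `ext_blockIdeal_subsingleton_of_two_le` (`Ext^{≥2}_R(I_S, −) = 0`);
* SINGLE-BLOCK MODELS (file XVI's `Blocks ι n` with `ι` a one-element type — e.g. file XIX's `Blocks.single S`, file
  XXI's `Blocks.full n`; free coordinates allowed): `arrIdeal_eq_blockIdeal`, the instances transported along the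
  ideal equality, **`deltaEquivOfUnique : Hom_R(I_M, R/I_M) ≃ₗ[R] Ext¹_R(I_M, I_M)`** (file XXV's `deltaEquivOfPD` fed
  with `pd ≤ 1` from here and `Hom_R(I_M, R) = R·ι` from file XVI) and, with file XIX's `blockNormalModuleEquiv`,
  **`extOneEquivOfUnique : Ext¹_R(I_M, I_M) ≃ₗ[R] BranchFunctions K B = Π_{(i,a,b)} R/(x_b, x_a)`** — EXT-NOTE §6.B(b)
  «`𝓔xt¹(I_Z, I_Z) = 𝓝′ = ⊕_B ν_{B*} N_{B/X}`» at every point `q` of `Z_T` lying on exactly ONE translate `W + t`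
  (germ `K_S × 𝔸^{n−|S|}`, `S = S_t(q)` of file XXIV; in particular every point of `W` itself), every `n`, every
  commutative `K`; `embeddedDeformationEquivExtOfUnique` — its embedded first-order deformations ≃ `Ext¹_R(I_M, I_M)`;
* `nontrivial_extOne_of_branch`, **`projectiveDimension_eq_one_of_branch`, `projectiveDimension_blockIdeal_eq_one`,
  `projectiveDimension_srDesignIdeal_eq_one` — `pd = 1` EXACTLY** (EXT-NOTE §6.A «So `pd_R I_{K_S} = 1`» as printed,
  `|S| ≥ 2`, `K` non-trivial: `Ext¹_R(I_S, I_S) ≅ Π_t R/(x_b, x_a) ≠ 0`, so `I_S` is not projective), as Mathlib's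
  `projectiveDimension (ModuleCat.of R I_S) = 1` in `WithBot ℕ∞`.
* `hasProjectiveDimensionLE_one_srDesignIdeal'`, **`deltaEquiv'`** — file XXV's `pd_R I_W ≤ 1` and
  `δ : Hom_R(I_W, R/I_W) ≃ₗ[R] Ext¹_R(I_W, I_W)` for the SR design WITHOUT the domain hypothesis (`n ≥ 1`; via file
  XXI's `arrIdeal_full`).
SCOPE: single-block germs only; at a CROSSING germ `M(S_1, …, S_r)`, `r ≥ 2` (EXT-NOTE §6.0), `pd_R I_M = r` and the
surjectivity half of §6.B(b) (paper: Künneth + the graded count of file XXIII) is NOT covered — only the injectivity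
half (file XXV's `BlockModel.delta_injective`); (H-arr)'s global half and (H-NC) stay binders; (S5)'s status word is
unchanged by this file.  References (dictionary only): EXT-NOTE.md §6.A, §6.B(b); G2-REDUCIBLE-POINT-THEOREM.md §2.
-/

open CategoryTheory CategoryTheory.Abelian MvPolynomial Finset
open scoped BigOperators

universe u

namespace Summit.Ventures.HSemireg.ObstructionLocus.BlockModel

variable {K : Type u} [CommRing K] {n : ℕ}

/-! ## Hilbert–Burch for the block ideal `I_S` over any commutative ring -/

/-- The presentation `R^S ↠ I_S`, `c ↦ Σ_{a ∈ S} c_a · x_{S ∖ a}`. -/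
noncomputable def blockGenMap (S : Finset (Fin n)) :
    (↥S → MvPolynomial (Fin n) K) →ₗ[MvPolynomial (Fin n) K] ↥(blockIdeal K S) :=
  ∑ a : ↥S, (LinearMap.proj a).smulRight ⟨sq (S.erase a.1), sq_erase_mem a.2⟩

/-- `blockGenMap c = Σ_a c_a x_{S∖a}`. -/
theorem blockGenMap_apply_coe (S : Finset (Fin n)) (c : ↥S → MvPolynomial (Fin n) K) :
    (blockGenMap S c : MvPolynomial (Fin n) K) = ∑ a : ↥S, c a * sq (S.erase a.1) := by
  simp [blockGenMap, LinearMap.sum_apply, LinearMap.smulRight_apply]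

/-- `I_S` is the span of the range of `a ↦ x_{S∖a}` on `↥S`. -/
theorem blockIdeal_eq_span_range (S : Finset (Fin n)) :
    blockIdeal K S = Ideal.span (Set.range fun a : ↥S => (sq (S.erase a.1) : MvPolynomial (Fin n) K)) := by
  unfold blockIdeal
  congr 1
  ext f
  constructor
  · rintro ⟨a, ha, rfl⟩
    exact ⟨⟨a, ha⟩, rfl⟩
  · rintro ⟨a, rfl⟩
    exact ⟨a.1, a.2, rfl⟩

/-- `blockGenMap` is onto `I_S`. -/
theorem blockGenMap_surjective (S : Finset (Fin n)) : Function.Surjective (blockGenMap (K := K) S) := by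
  rintro ⟨f, hf⟩
  rw [blockIdeal_eq_span_range] at hf
  obtain ⟨c, hc⟩ := Ideal.mem_span_range_iff_exists_fun.1 hf
  exact ⟨c, Subtype.ext (by rw [blockGenMap_apply_coe]; exact hc)⟩

/-- If every monomial of `p` has a positive `a`-exponent, then `x_a ∣ p` (any commutative coefficient ring). -/
theorem exists_eq_X_mul_of_forall_support {a : Fin n} {p : MvPolynomial (Fin n) K}
    (h : ∀ e ∈ p.support, e a ≠ 0) : ∃ q : MvPolynomial (Fin n) K, p = X a * q := by
  have hmem : p ∈ Ideal.span ((fun i => (X i : MvPolynomial (Fin n) K)) '' {a}) := by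
    rw [mem_ideal_span_X_image]
    intro e he
    exact ⟨a, Set.mem_singleton a, h e he⟩
  rw [Set.image_singleton, Ideal.mem_span_singleton'] at hmem
  obtain ⟨q, hq⟩ := hmem
  exact ⟨q, by rw [← hq, mul_comm]⟩

/-- Every monomial of `x_a · q` has a positive `a`-exponent. -/
theorem apply_ne_zero_of_mem_support_X_mul {a : Fin n} {q : MvPolynomial (Fin n) K} {e : Fin n →₀ ℕ}
    (he : e ∈ (X a * q).support) : e a ≠ 0 := by
  rw [support_X_mul, Finset.mem_map] at he
  obtain ⟨e', -, rfl⟩ := he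
  simp

/-- **The first syzygies of `(x_{S∖a})_{a ∈ S}` over ANY commutative ring `K`** (Hilbert–Burch shape of `I_S`,
EXT-NOTE §6.A): `Σ_a c_a x_{S∖a} = 0` iff `c_a = x_a s_a` for some `s` with `Σ_a s_a = 0`.  (Reduce the relation
modulo `x_a`: every other generator is divisible by `x_a`, and `x_{S∖a}` does not involve `x_a`, so every monomial of
`c_a` carries `x_a`; then `(Σ s_a) · x_S = 0` and `x_S` is a non-zero-divisor.) -/
theorem sum_mul_sq_erase_eq_zero_iff (S : Finset (Fin n)) (c : ↥S → MvPolynomial (Fin n) K) :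
    ∑ a : ↥S, c a * sq (S.erase a.1) = 0 ↔
      ∃ s : ↥S → MvPolynomial (Fin n) K, (∀ a, c a = X a.1 * s a) ∧ ∑ a, s a = 0 := by
  constructor
  · intro h
    have hdvd : ∀ a : ↥S, ∃ q : MvPolynomial (Fin n) K, c a = X a.1 * q := by
      intro a
      -- the other generators are divisible by `x_a`
      have hother : ∀ b : ↥S, b ≠ a →
          c b * sq (S.erase b.1) = X a.1 * (c b * sq ((S.erase b.1).erase a.1)) := by
        intro b hb
        have hab : a.1 ∈ S.erase b.1 := Finset.mem_erase.2 ⟨fun h' => hb (Subtype.ext h'.symm), a.2⟩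
        rw [← X_mul_sq_erase hab]
        ring
      have h1 : c a * sq (S.erase a.1) = X a.1 * (-∑ b ∈ univ.erase a, c b * sq ((S.erase b.1).erase a.1)) := by
        rw [← Finset.add_sum_erase univ (fun b : ↥S => c b * sq (S.erase b.1)) (mem_univ a)] at h
        have h2 : ∑ b ∈ univ.erase a, c b * sq (S.erase b.1)
            = X a.1 * ∑ b ∈ univ.erase a, c b * sq ((S.erase b.1).erase a.1) := by
          rw [Finset.mul_sum]
          exact Finset.sum_congr rfl fun b hb => hother b (Finset.mem_erase.1 hb).1
        rw [h2] at h
        linear_combination h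
      apply exists_eq_X_mul_of_forall_support
      intro e he
      have he' : e + ind (S.erase a.1) ∈ (c a * sq (S.erase a.1)).support := by
        rw [mem_support_iff, mul_comm, coeff_sq_mul_add]
        exact mem_support_iff.1 he
      rw [h1] at he'
      have := apply_ne_zero_of_mem_support_X_mul he'
      rwa [Finsupp.add_apply, ind_apply_of_notMem (Finset.notMem_erase a.1 S), add_zero] at this
    choose s hs using hdvd
    refine ⟨s, hs, ?_⟩
    have hP : sq S * (∑ a, s a) = 0 := by
      rw [Finset.mul_sum, ← h]
      refine Finset.sum_congr rfl fun a _ => ?_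
      rw [hs a, ← X_mul_sq_erase a.2]
      ring
    exact eq_zero_of_sq_mul_eq_zero hP
  · rintro ⟨s, hs, hsum⟩
    calc ∑ a : ↥S, c a * sq (S.erase a.1) = ∑ a : ↥S, s a * (X a.1 * sq (S.erase a.1)) :=
          Finset.sum_congr rfl fun a _ => by rw [hs a]; ring
      _ = (∑ a : ↥S, s a) * sq S := by
          rw [Finset.sum_mul]
          exact Finset.sum_congr rfl fun a _ => by rw [X_mul_sq_erase a.2]
      _ = 0 := by rw [hsum, zero_mul]

/-- The Hilbert–Burch map `s ↦ (x_a s_a)_{a ∈ S}` on `R^S`. -/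
noncomputable def smulXBlock (S : Finset (Fin n)) :
    (↥S → MvPolynomial (Fin n) K) →ₗ[MvPolynomial (Fin n) K] (↥S → MvPolynomial (Fin n) K) :=
  LinearMap.pi fun a => (X a.1 : MvPolynomial (Fin n) K) • LinearMap.proj a

/-- Components of `smulXBlock`. -/
theorem smulXBlock_apply (S : Finset (Fin n)) (s : ↥S → MvPolynomial (Fin n) K) (a : ↥S) :
    smulXBlock S s a = X a.1 * s a := by simp [smulXBlock, smul_eq_mul]

/-- `smulXBlock` is injective (`x_a` is a non-zero-divisor over any commutative ring). -/
theorem smulXBlock_injective (S : Finset (Fin n)) : Function.Injective (smulXBlock (K := K) S) := by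
  intro s t hst
  funext a
  have := congr_fun hst a
  rw [smulXBlock_apply, smulXBlock_apply] at this
  exact X_mul_cancel_left_iff.1 this

/-- `smulXBlock` maps `ker Σ` into the syzygy module. -/
theorem smulXBlock_mem_ker (S : Finset (Fin n))
    (s : LinearMap.ker (sumMap (MvPolynomial (Fin n) K) ↥S)) :
    smulXBlock S (s : ↥S → MvPolynomial (Fin n) K) ∈ LinearMap.ker (blockGenMap (K := K) S) := by
  rw [LinearMap.mem_ker]
  apply Subtype.ext
  rw [blockGenMap_apply_coe]
  change ∑ a : ↥S, smulXBlock S (s : ↥S → MvPolynomial (Fin n) K) a * sq (S.erase a.1) = 0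
  simp only [smulXBlock_apply]
  rw [sum_mul_sq_erase_eq_zero_iff]
  refine ⟨s, fun a => rfl, ?_⟩
  rw [← sumMap_apply]
  exact s.2

/-- **Hilbert–Burch for `I_S`, module form (any commutative `K`)**: the syzygy module `ker(R^S ↠ I_S)` is
`≃ₗ ker(Σ : R^S → R)` under `s ↦ (x_a s_a)_a`. -/
noncomputable def kerBlockGenMapEquiv (S : Finset (Fin n)) :
    LinearMap.ker (sumMap (MvPolynomial (Fin n) K) ↥S)
      ≃ₗ[MvPolynomial (Fin n) K] LinearMap.ker (blockGenMap (K := K) S) :=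
  LinearEquiv.ofBijective
    (LinearMap.codRestrict _ (smulXBlock S ∘ₗ (LinearMap.ker (sumMap (MvPolynomial (Fin n) K) ↥S)).subtype)
      (smulXBlock_mem_ker S))
    (by
      constructor
      · intro s t hst
        apply Subtype.ext
        have h := congr_arg Subtype.val hst
        simp only [LinearMap.codRestrict_apply, LinearMap.comp_apply, Submodule.subtype_apply] at h
        exact smulXBlock_injective S h
      · rintro ⟨r, hr⟩
        have h0 : ∑ a : ↥S, r a * sq (S.erase a.1) = 0 := by
          rw [← blockGenMap_apply_coe, LinearMap.mem_ker.1 hr]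
          rfl
        obtain ⟨s, hs, hsum⟩ := (sum_mul_sq_erase_eq_zero_iff S r).1 h0
        refine ⟨⟨s, by rw [LinearMap.mem_ker, sumMap_apply, hsum]⟩, Subtype.ext ?_⟩
        simp only [LinearMap.codRestrict_apply, LinearMap.comp_apply, Submodule.subtype_apply]
        funext a
        rw [smulXBlock_apply]
        exact (hs a).symm)

/-- Hence **the syzygy module of `I_S` is projective**. -/
instance projective_kerBlockGenMap (S : Finset (Fin n)) :
    Module.Projective (MvPolynomial (Fin n) K) (LinearMap.ker (blockGenMap (K := K) S)) :=
  haveI := projective_kerSumMap (A := MvPolynomial (Fin n) K) ↥S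
  Module.Projective.of_equiv (kerBlockGenMapEquiv S)

/-- `I_S` is a finitely generated `R`-module. -/
instance finite_blockIdeal (S : Finset (Fin n)) : Module.Finite (MvPolynomial (Fin n) K) ↥(blockIdeal K S) :=
  Module.Finite.of_surjective (blockGenMap S) (blockGenMap_surjective S)

/-- **`pd_R I_S ≤ 1` for every block `S`, every `n`, EVERY commutative ring `K`** (EXT-NOTE §6.A, Hilbert–Burch
`0 → R^{|S|−1} → R^S → I_S → 0`), as Mathlib's `HasProjectiveDimensionLE`. -/
instance hasProjectiveDimensionLE_one_blockIdeal (S : Finset (Fin n)) :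
    HasProjectiveDimensionLE (ModuleCat.of (MvPolynomial (Fin n) K) ↥(blockIdeal K S)) 1 :=
  (LinearMap.shortExact_shortComplexKer (blockGenMap_surjective (K := K) S)).hasProjectiveDimensionLT_X₃ 1
    inferInstance inferInstance

/-- Hence `Ext^i_R(I_S, N) = 0` for `i ≥ 2` and every `N`. -/
theorem ext_blockIdeal_subsingleton_of_two_le (S : Finset (Fin n))
    (N : ModuleCat.{u} (MvPolynomial (Fin n) K)) {i : ℕ} (hi : 2 ≤ i) :
    Subsingleton (Ext.{u} (ModuleCat.of (MvPolynomial (Fin n) K) ↥(blockIdeal K S)) N i) :=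
  HasProjectiveDimensionLT.subsingleton _ 2 i hi N

/-! ## Transport along an equality of ideals -/

/-- `pd ≤ 1` transports along an equality of ideals. -/
theorem hasProjectiveDimensionLE_one_of_eq {J : Ideal (MvPolynomial (Fin n) K)} {S : Finset (Fin n)}
    (hJ : J = blockIdeal K S) : HasProjectiveDimensionLE (ModuleCat.of (MvPolynomial (Fin n) K) ↥J) 1 := by
  subst hJ; infer_instance

/-- Finite generation transports along an equality of ideals. -/
theorem finite_of_eq {J : Ideal (MvPolynomial (Fin n) K)} {S : Finset (Fin n)} (hJ : J = blockIdeal K S) :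
    Module.Finite (MvPolynomial (Fin n) K) ↥J := by
  subst hJ; infer_instance

/-! ## Single-block models: `Ext¹_R(I_M, I_M) = Hom_R(I_M, R/I_M)` over any commutative ring -/

section SingleBlock

variable {ι : Type*} [Fintype ι] [Unique ι]

omit [Fintype ι] in
/-- With one block, the arrangement ideal is the block ideal. -/
theorem arrIdeal_eq_blockIdeal (B : Blocks ι n) : arrIdeal K B = blockIdeal K (B.S default) := by
  show ⨅ i, blockIdeal K (B.S i) = blockIdeal K (B.S default)
  exact iInf_unique (f := fun i => blockIdeal K (B.S i))

omit [Fintype ι] in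
/-- `pd_R I_M ≤ 1` for a single-block model (every commutative `K`). -/
instance hasProjectiveDimensionLE_one_arrIdeal (B : Blocks ι n) :
    HasProjectiveDimensionLE (ModuleCat.of (MvPolynomial (Fin n) K) ↥(arrIdeal K B)) 1 :=
  hasProjectiveDimensionLE_one_of_eq (arrIdeal_eq_blockIdeal B)

omit [Fintype ι] in
/-- `I_M` is finitely generated (single block, any `K`). -/
instance finite_arrIdeal (B : Blocks ι n) : Module.Finite (MvPolynomial (Fin n) K) ↥(arrIdeal K B) :=
  finite_of_eq (arrIdeal_eq_blockIdeal B)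

variable (K) in
/-- **EXT-NOTE §6.B(b) for every SINGLE-BLOCK model over ANY commutative ring: the connecting homomorphism
`δ : Hom_R(I_M, R/I_M) ≃ₗ[R] Ext¹_R(I_M, I_M)` is an isomorphism** (`pd ≤ 1` from the block syzygies; `Hom_R(I_M, R) =
R·ι` from file XVI). -/
noncomputable def deltaEquivOfUnique (B : Blocks ι n) :
    (↥(arrIdeal K B) →ₗ[MvPolynomial (Fin n) K] MvPolynomial (Fin n) K ⧸ arrIdeal K B)
      ≃ₗ[MvPolynomial (Fin n) K]
        Ext.{u} (ModuleCat.of (MvPolynomial (Fin n) K) ↥(arrIdeal K B))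
          (ModuleCat.of (MvPolynomial (Fin n) K) ↥(arrIdeal K B)) 1 :=
  deltaEquivOfPD (arrIdeal K B) fun ψ => mkQ_comp_hom_to_ring_eq_zero B ψ

/-- `deltaEquivOfUnique` is file XXV's `δ`. -/
theorem deltaEquivOfUnique_apply (B : Blocks ι n)
    (φ : ↥(arrIdeal K B) →ₗ[MvPolynomial (Fin n) K] MvPolynomial (Fin n) K ⧸ arrIdeal K B) :
    deltaEquivOfUnique K B φ = delta (arrIdeal K B) φ := rfl

variable (K) in
/-- **`Ext¹_R(I_M, I_M) ≃ₗ[R] Π_{(i,a,b)} R/(x_b, x_a)` for every single-block model over any commutative ring** —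
Mathlib's derived `Ext¹` of the ideal of `K_S × 𝔸^{[n]∖S}` with itself IS file XIX's module of branch functions
(«`𝓔xt¹(I_Z, I_Z) = 𝓝′ = ⊕_B ν_{B*} N_{B/X}`» at every point of `Z_T` lying on exactly one translate). -/
noncomputable def extOneEquivOfUnique [DecidableEq ι] (B : Blocks ι n) :
    Ext.{u} (ModuleCat.of (MvPolynomial (Fin n) K) ↥(arrIdeal K B))
        (ModuleCat.of (MvPolynomial (Fin n) K) ↥(arrIdeal K B)) 1
      ≃ₗ[MvPolynomial (Fin n) K] BranchFunctions K B :=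
  (deltaEquivOfUnique K B).symm ≪≫ₗ blockNormalModuleEquiv K B

variable (K) in
/-- The embedded first-order deformations of a single-block model `M ⊂ 𝔸ⁿ` in `𝔸ⁿ × Spec K[ε]` correspond bijectively
to `Ext¹_R(I_M, I_M)` (Hartshorne Prop. 2.3 ∘ §6.B(b); file XXV's `embeddedDeformationEquivExt`), any `K`. -/
noncomputable def embeddedDeformationEquivExtOfUnique (B : Blocks ι n) :
    {J : Ideal (DualNumber (MvPolynomial (Fin n) K)) // EmbeddedDeformation.IsEmbeddedDeformation (arrIdeal K B) J}
      ≃ Ext.{u} (ModuleCat.of (MvPolynomial (Fin n) K) ↥(arrIdeal K B))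
          (ModuleCat.of (MvPolynomial (Fin n) K) ↥(arrIdeal K B)) 1 :=
  embeddedDeformationEquivExt (arrIdeal K B) fun ψ => mkQ_comp_hom_to_ring_eq_zero B ψ

end SingleBlock

/-! ## `pd_R I_M = 1` EXACTLY (EXT-NOTE §6.A as printed) for single-block models with a branch -/

section Exact

variable [Nontrivial K] {ι : Type*} [Fintype ι] [DecidableEq ι] [Unique ι]

/-- `(x_j, x_k)` is a proper ideal (constant coefficients vanish). -/
theorem span_X_pair_ne_top (j k : Fin n) : Ideal.span {(X j : MvPolynomial (Fin n) K), X k} ≠ ⊤ := by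
  rw [Ne, Ideal.eq_top_iff_one, Ideal.mem_span_pair]
  rintro ⟨a, b, hab⟩
  have := congr_arg constantCoeff hab
  simp at this

omit [Nontrivial K] [Fintype ι] [DecidableEq ι] [Unique ι] in
/-- A block of size `≥ 2` has a branch datum `(i, a, b)`. -/
theorem nonempty_branch_of_two_le (B : Blocks ι n) (i : ι) (h : 2 ≤ (B.S i).card) : Nonempty (Branch B) := by
  obtain ⟨a, ha, b, hb, hab⟩ := Finset.one_lt_card.1 h
  exact ⟨⟨(i, a, b), ha, Finset.mem_erase.2 ⟨fun h' => hab h'.symm, hb⟩⟩⟩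

/-- If the single-block model has a branch, `Ext¹_R(I_M, I_M) ≠ 0` (it is `Π_t R/(x_b, x_a)`, each factor `≠ 0`). -/
theorem nontrivial_extOne_of_branch (B : Blocks ι n) (t : Branch B) :
    Nontrivial (Ext.{u} (ModuleCat.of (MvPolynomial (Fin n) K) ↥(arrIdeal K B))
      (ModuleCat.of (MvPolynomial (Fin n) K) ↥(arrIdeal K B)) 1) := by
  classical
  haveI : Nontrivial (MvPolynomial (Fin n) K ⧸
      Ideal.span {(X t.1.2.2 : MvPolynomial (Fin n) K), X t.1.2.1}) :=
    Ideal.Quotient.nontrivial_iff.2 (span_X_pair_ne_top _ _)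
  let v : BranchFunctions K B := Pi.single t 1
  have hv : v ≠ 0 := by
    intro h
    have h1 := congr_fun h t
    simp only [v, Pi.single_eq_same, Pi.zero_apply] at h1
    exact one_ne_zero h1
  exact nontrivial_of_ne ((extOneEquivOfUnique K B).symm v) ((extOneEquivOfUnique K B).symm 0)
    fun h => hv ((extOneEquivOfUnique K B).symm.injective h)

/-- … hence `I_M` is not of projective dimension `< 1`. -/
theorem not_hasProjectiveDimensionLT_one_of_branch (B : Blocks ι n) (t : Branch B) :
    ¬ HasProjectiveDimensionLT (ModuleCat.of (MvPolynomial (Fin n) K) ↥(arrIdeal K B)) 1 := by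
  intro h
  haveI := nontrivial_extOne_of_branch (K := K) B t
  haveI := HasProjectiveDimensionLT.subsingleton
    (ModuleCat.of (MvPolynomial (Fin n) K) ↥(arrIdeal K B)) 1 1 le_rfl
    (ModuleCat.of (MvPolynomial (Fin n) K) ↥(arrIdeal K B))
  exact false_of_nontrivial_of_subsingleton
    (Ext.{u} (ModuleCat.of (MvPolynomial (Fin n) K) ↥(arrIdeal K B))
      (ModuleCat.of (MvPolynomial (Fin n) K) ↥(arrIdeal K B)) 1)

/-- **`pd_R I_M = 1` EXACTLY for every single-block model with a branch (block of size `≥ 2`), every `n`, every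
non-trivial commutative `K`** (EXT-NOTE §6.A «So `pd_R I_{K_S} = 1`», `k = |S| ≥ 2`, as printed), as Mathlib's
`projectiveDimension` in `WithBot ℕ∞`. -/
theorem projectiveDimension_eq_one_of_branch (B : Blocks ι n) (t : Branch B) :
    projectiveDimension (ModuleCat.of (MvPolynomial (Fin n) K) ↥(arrIdeal K B)) = 1 := by
  apply le_antisymm
  · exact (projectiveDimension_le_iff _ 1).2 inferInstance
  · exact (projectiveDimension_ge_iff _ 1).2 (not_hasProjectiveDimensionLT_one_of_branch B t)

end Exact

/-- **`pd_R I_S = 1` EXACTLY for every block `S` with `|S| ≥ 2`** (every `n`, every non-trivial commutative `K`). -/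
theorem projectiveDimension_blockIdeal_eq_one [Nontrivial K] (S : Finset (Fin n)) (hS : 2 ≤ S.card) :
    projectiveDimension (ModuleCat.of (MvPolynomial (Fin n) K) ↥(blockIdeal K S)) = 1 := by
  have hS' : S.Nonempty := Finset.card_pos.1 (by omega)
  rw [← arrIdeal_single (K := K) S hS']
  obtain ⟨t⟩ := nonempty_branch_of_two_le (Blocks.single S hS') () hS
  exact projectiveDimension_eq_one_of_branch (Blocks.single S hS') t

/-! ## The SR design without the domain hypothesis -/

/-- **`pd_R I_W = 1` EXACTLY for `n ≥ 2`, every non-trivial commutative `K`** (via `I_W = I_{[n]}`). -/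
theorem projectiveDimension_srDesignIdeal_eq_one [Nontrivial K] (hn : 2 ≤ n) :
    projectiveDimension (ModuleCat.of (MvPolynomial (Fin n) K) ↥(srDesignIdeal K n)) = 1 := by
  rw [← blockIdeal_univ (K := K) (n := n)]
  exact projectiveDimension_blockIdeal_eq_one _ (by simpa using hn)

/-- `pd_R I_W ≤ 1` over ANY commutative ring `K` (file XXV: domains), via `I_W = I_{[n]}` (file XV's
`blockIdeal_univ`). -/
instance hasProjectiveDimensionLE_one_srDesignIdeal' :
    HasProjectiveDimensionLE (ModuleCat.of (MvPolynomial (Fin n) K) ↥(srDesignIdeal K n)) 1 :=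
  hasProjectiveDimensionLE_one_of_eq (blockIdeal_univ (K := K) (n := n)).symm

/-- **File XXV's `deltaEquiv` WITHOUT the domain hypothesis** (`n ≥ 1`): for every commutative ring `K`,
`δ : Hom_R(I_W, R/I_W) ≃ₗ[R] Ext¹_R(I_W, I_W)` (via file XXI's `Blocks.full n`, `arrIdeal_full`). -/
noncomputable def deltaEquiv' [NeZero n] :
    (↥(srDesignIdeal K n) →ₗ[MvPolynomial (Fin n) K] MvPolynomial (Fin n) K ⧸ srDesignIdeal K n)
      ≃ₗ[MvPolynomial (Fin n) K]
        Ext.{u} (ModuleCat.of (MvPolynomial (Fin n) K) ↥(srDesignIdeal K n))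
          (ModuleCat.of (MvPolynomial (Fin n) K) ↥(srDesignIdeal K n)) 1 := by
  have h : srDesignIdeal K n = arrIdeal K (Blocks.full n) := (arrIdeal_full (K := K) (n := n)).symm
  rw [h]
  exact deltaEquivOfUnique K (Blocks.full n)

end Summit.Ventures.HSemireg.ObstructionLocus.BlockModel
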